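import Summits.CriticalPhenomena.CardyFormulaZ2.Theorems.CardyComplexConeSLESixFamiliesGiveCardyUpperFencePart4
import HarnessLib

/-!
# Stub `upperFence` of line `collar-touch-sandwich` — `theorem stub_upperFence : UpperFence`

Crux `SLESixFamiliesGiveCardy` (stmt-CriticalPhenomena-9654), route `CardyComplexCone`.  The
deterministic UPPER half of the touch sandwich, registered STUB A of the checked skeleton
`Cruxes/SLESixFamiliesGiveCardy/Lines/collar-touch-sandwich.lean`: under `UpperCollarGeom R D G`,
for every discretisation family `Λ` of the designer Dobrushin domain `D ⊇ Ω` and every `η > 0`,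
for all small meshes `δ`,
`discreteCrossing Ω δ (ab) (cd) ⊆ {ω | trace (medialExplorationCurve (Λ δ) ω) meets cthickening η G}`.

This file only fixes the `ω`-free constants (collar margins `r₀`, `r₂`, the separation `ρ` of the
arcs `(ab)`, `(cd)`, the uniform side-ball radii `τ_a`, `τ_b` at the two marks —
`exists_uniform_side_ball`, Part 1 — and `ε₀ < min τ / 4`), intersects the finitely many
eventualities in the mesh (admissibility, discrete marked points at the marks, dual-wired sites
near the touch set, eventual monotonicity `Ω_δ ≤ D_δ`, connector exclusion) and calls the kernel
`upperFence_kernel` (Part 4), whose proof is Newman's cross-cut theorem applied to the cleaned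
open crossing against the perturbed exploration polygon (see Part 4).
-/

noncomputable section

open Set Filter Topology Metric
open scoped NNReal
open Literature.Probability Literature.Probability.RandomPlanarGeometry
  Literature.Probability.LatticeModels Literature.Probability.Percolation

namespace Summit.CriticalPhenomena.CardyFormulaZ2.Cruxes.SLESixFamiliesGiveCardy.CollarTouchSandwich

/-- **STUB A — the upper fence inclusion.** -/
theorem stub_upperFence : UpperFence := by
  intro R D G hg Λ hΛ η hη
  -- `ω`-free constants
  obtain ⟨r₀, hr₀, h₀⟩ := hg.near_arc_zero
  obtain ⟨r₂, hr₂, h₂⟩ := hg.near_arc_two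
  obtain ⟨ρ, hρ, hρlt⟩ := MarkedDomain.exists_pos_forall_lt_dist_arc R
  obtain ⟨τa, hτa0, hballa, hsidea⟩ :=
    exists_uniform_side_ball D.toJordanDomain isClosed_closure (u₀ := D.mark 0)
      (hg.pt_not_mem_closure 0)
  obtain ⟨τb, hτb0, hballb, hsideb⟩ :=
    exists_uniform_side_ball D.toJordanDomain isClosed_closure (u₀ := D.mark 1)
      (hg.pt_not_mem_closure 1)
  set ε₀ : ℝ := min τa τb / 4 with hε₀
  have hε₀pos : 0 < ε₀ := by positivity
  have hε₀a : 4 * ε₀ ≤ τa := by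
    have := min_le_left τa τb; rw [hε₀]; linarith
  have hε₀b : 4 * ε₀ ≤ τb := by
    have := min_le_right τa τb; rw [hε₀]; linarith
  have hGne : G.Nonempty := upperCollarGeom_touch_nonempty hg
  filter_upwards [eventually_mesh_pos, eventually_mesh_lt (half_pos hr₀),
    eventually_mesh_lt (half_pos hr₂), eventually_mesh_lt (by positivity : 0 < ρ / 4),
    eventually_mesh_lt hε₀pos, eventually_mesh_lt (half_pos hη), hΛ.eventually_isZdAdmissible,
    eventually_zdABEdges_near_pt hΛ hε₀pos, upperFence_dual_near_touch' hg hΛ hη,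
    UpperCollarGeom.eventually_discreteDomainGraph_le hg,
    UpperCollarGeom.eventually_connector_not_adj hg]
    with δ hδ hδr₀ hδr₂ hδρ hδε hδη hE hmarks hnear hle hconn
  intro ω hω
  have hΩ := hΛ.Ω_eq δ
  have hδE := hΛ.δ_eq δ
  exact upperFence_kernel (E := Λ δ) (G := G) (ε₀ := ε₀) (η := η) R D hE hΩ hg.carrier_subset
    hg.pt_not_mem_closure h₀ h₂ (by rw [hδE]; linarith) (by rw [hδE]; linarith)
    (fun p hp q hq => (hρlt p hp q hq).le) (by rw [hδE]; linarith) hτa0 hτb0 hballa hsidea hballb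
    hsideb (by rw [hδE]; exact hmarks) (by rw [hδE]; linarith) (by rw [hδE]; linarith) hGne
    (by rw [hδE]; linarith) (by rw [hδE]; exact hnear) (by rw [hδE, hΩ]; exact hle.2)
    (by rw [hδE, hΩ]; exact hconn) (by rw [hδE]; exact hω)

end Summit.CriticalPhenomena.CardyFormulaZ2.Cruxes.SLESixFamiliesGiveCardy.CollarTouchSandwich

end
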